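import Mathlib
import Summits.Ventures.PercRepro2.LocRows
import Summits.Ventures.PercRepro2.SwRow
import Summits.Ventures.PercRepro2.SwOut
import Summits.Ventures.PercRepro2.SwAllRow
import Summits.Ventures.PercRepro2.SwOutAll

/-!
# Flipping an arm of a core-free configuration (blind cell PercRepro2, night-4 g10, 2026-08-25;
proofs/NIGHT4-G10.md §7, the ARM PRINCIPLE, part 1)

A configuration is CORE-FREE at `h` when its red and blue clusters of `h` meet only in `h`
(`CoreFree`).  Its hull minus `h` splits into ARMS — the components of the graph induced on
`hull ∖ {h}` — and each arm lies on one side (no edge joins the red side to the blue side, else the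
two ends would form a core).  A vertex set `P ⊆ hull ∖ {h}` is ARM-CLOSED when no edge joins `P` to
the rest of `hull ∖ {h}` (`ArmClosed`: a union of arms).  Flipping every edge touching `P`
(`Hull.flip ends P`) exchanges the sides of the arms in `P` and nothing else:

* `cluster_flip_of_armClosed`: `C_R(h)(flip P ζ) = (C_R(h)(ζ) ∖ P) ∪ (P ∩ C_B(h)(ζ))`, and the blue
  version `cluster_blue_flip_of_armClosed`; the hull is unchanged (`hull_flip_of_armClosed`) and the
  result is core-free (`coreFree_flip_of_armClosed`);
* `flip_mem_outClass_of_armClosed`: the outside class is kept;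
* `flip_mem_tgtU_of_armClosed_red`: flipping RED arms to blue keeps the conditioning `Q` — the red
  cluster of `l` grows, the blue one shrinks, `h` stays disconnected from `l` (the monotonicity of
  `Q` along the arm cube).
-/

namespace Summit.Ventures.PercRepro2

namespace LocRows

open Hull

variable {V : Type*} {E : Type*} [Fintype E] [DecidableEq E]

open scoped Classical

variable {ends : E → Sym2 V}

/-- The two clusters of `h` meet only in `h`. -/
def CoreFree (ends : E → Sym2 V) (ζ : Config E) (h : V) : Prop :=
  ∀ x, x ∈ cluster ends ζ h → x ∈ cluster ends (blue ζ) h → x = h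

/-- `P` is a union of arms: inside `hull ∖ {h}`, and no edge joins `P` to the rest of `hull ∖ {h}`. -/
structure ArmClosed (ends : E → Sym2 V) (ζ : Config E) (h : V) (P : Set V) : Prop where
  subset : ∀ x ∈ P, x ∈ hull ends ζ h ∧ x ≠ h
  closed : ∀ e x y, ends e = s(x, y) → x ∈ P → y ∈ hull ends ζ h → y ≠ h → y ∈ P

section ArmFlip

variable {ζ : Config E} {h : V} {P : Set V}

omit [Fintype E] [DecidableEq E] in
/-- Core-freeness is colour-symmetric. -/
lemma CoreFree.blue (hc : CoreFree ends ζ h) : CoreFree ends (blue ζ) h := by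
  intro x hx hx'
  rw [blue_blue] at hx'
  exact hc x hx' hx

omit [Fintype E] [DecidableEq E] in
/-- Arm-closedness is colour-symmetric. -/
lemma ArmClosed.blue (hP : ArmClosed ends ζ h P) : ArmClosed ends (blue ζ) h P := by
  refine ⟨fun x hx => ?_, fun e x y hxy hx hy hyh => ?_⟩
  · rw [hull_blue]; exact hP.subset x hx
  · rw [hull_blue] at hy; exact hP.closed e x y hxy hx hy hyh

omit [Fintype E] [DecidableEq E] in
/-- No edge joins the red side to the blue side of a core-free configuration (other than at `h`). -/
lemma no_edge_sides_of_coreFree (hc : CoreFree ends ζ h) {e : E} {x y : V} (hxy : ends e = s(x, y))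
    (hx : x ∈ cluster ends ζ h) (hxh : x ≠ h) (hy : y ∈ cluster ends (blue ζ) h) (hyh : y ≠ h) :
    False := by
  cases he : ζ e with
  | true => exact hyh (hc y (mem_cluster_of_edge hx he hxy) hy)
  | false =>
    have he' : blue ζ e = true := by rw [blue_eq_true_iff]; exact he
    exact hxh (hc x hx (mem_cluster_of_edge hy he' (ends_swap hxy)))

omit [Fintype E] [DecidableEq E] in
/-- A star edge from `h` to a red vertex is red. -/
lemma red_of_star_red (hc : CoreFree ends ζ h) {e : E} {x : V} (hxe : ends e = s(h, x))
    (hx : x ∈ cluster ends ζ h) (hxh : x ≠ h) : ζ e = true := by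
  cases he : ζ e with
  | true => rfl
  | false =>
    have he' : blue ζ e = true := by rw [blue_eq_true_iff]; exact he
    exact absurd (hc x hx (mem_cluster_of_edge (mem_cluster_self _ _ _) he' hxe)) hxh

omit [Fintype E] [DecidableEq E] in
/-- **The red cluster after flipping a union of arms**: the red arms outside `P` stay, the blue arms
inside `P` become red. -/
theorem cluster_flip_of_armClosed (hc : CoreFree ends ζ h) (hP : ArmClosed ends ζ h P) :
    cluster ends (flip ends P ζ) h =
      (cluster ends ζ h \ P) ∪ (P ∩ cluster ends (blue ζ) h) := by
  have hhP : h ∉ P := fun hh => (hP.subset h hh).2 rfl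
  apply Set.Subset.antisymm
  · intro v hv
    refine mem_of_conn_of_closed (ends := ends) (ω := flip ends P ζ) ?_
      (Or.inl ⟨mem_cluster_self _ _ _, hhP⟩) hv
    intro a ha b hab
    obtain ⟨hne, e, he, hends⟩ := openGraph_adj.1 hab
    by_cases hte : e ∈ touches ends P
    · -- the edge was blue
      rw [flip_apply_of_mem hte] at he
      have hζe : ζ e = false := by cases hζe : ζ e <;> simp_all
      have hblue : blue ζ e = true := by rw [blue_eq_true_iff]; exact hζe
      rcases ha with ⟨haT, haP⟩ | ⟨haP, haTp⟩
      · -- `a` red outside `P`; the edge touches `P`, so `b ∈ P`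
        have hbP : b ∈ P := by
          rcases hte with ⟨x, hx, y, hxy⟩
          rw [hends, Sym2.eq_iff] at hxy
          rcases hxy with ⟨rfl, _⟩ | ⟨_, rfl⟩
          · exact absurd hx haP
          · exact hx
        -- `b ∈ P` and `a ∈ C_R(h)`; the blue edge puts `b` on the blue side unless `a = h`
        by_cases hah : a = h
        · subst hah
          exact Or.inr ⟨hbP, mem_cluster_of_edge (mem_cluster_self _ _ _) hblue hends⟩
        · -- `a ∈ hull ∖ {h}` outside `P` joined to `b ∈ P`: contradicts arm-closedness
          exact absurd (hP.closed e b a (ends_swap hends) hbP (Or.inl haT) hah) haP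
      · -- `a ∈ P` on the blue side: `b` is on the blue side; inside `P` or equal to `h`
        have hbTp : b ∈ cluster ends (blue ζ) h := mem_cluster_of_edge haTp hblue hends
        by_cases hbh : b = h
        · subst hbh; exact Or.inl ⟨mem_cluster_self _ _ _, hhP⟩
        · exact Or.inr ⟨hP.closed e a b hends haP (Or.inr hbTp) hbh, hbTp⟩
    · rw [flip_apply_of_notMem hte] at he
      have hbP : b ∉ P := fun hb => hte ⟨b, hb, a, ends_swap hends⟩
      have haP : a ∉ P := fun ha' => hte ⟨a, ha', b, hends⟩
      rcases ha with ⟨haT, _⟩ | ⟨haP', _⟩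
      · exact Or.inl ⟨mem_cluster_of_edge haT he hends, hbP⟩
      · exact absurd haP' haP
  · intro v hv
    rcases hv with ⟨hvT, hvP⟩ | ⟨hvP, hvTp⟩
    · -- red paths to vertices outside `P` avoid `P`
      have key : v ∈ {x | x ∈ cluster ends ζ h ∧ (x ∈ P ∨ x ∈ cluster ends (flip ends P ζ) h)} := by
        refine mem_of_conn_of_closed (ends := ends) (ω := ζ) ?_
          ⟨mem_cluster_self _ _ _, Or.inr (mem_cluster_self _ _ _)⟩ hvT
        intro a ha b hab
        obtain ⟨hne, e, he, hends⟩ := openGraph_adj.1 hab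
        have hbT : b ∈ cluster ends ζ h := mem_cluster_of_edge ha.1 he hends
        refine ⟨hbT, ?_⟩
        by_cases hbP : b ∈ P
        · exact Or.inl hbP
        · rcases ha.2 with haP | haF
          · by_cases hbh : b = h
            · subst hbh; exact Or.inr (mem_cluster_self _ _ _)
            · exact absurd (hP.closed e a b hends haP (Or.inl hbT) hbh) hbP
          · -- `a ∉ P` here: otherwise `a ∈ P ∩ C_R(h)` would be joined to `b ∉ P`, `b ≠ h`? we only
            -- know `a ∈ C_R(h)(flip)`; if `a ∈ P` the edge is flipped: handle both cases directly
            by_cases haP : a ∈ P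
            · by_cases hbh : b = h
              · subst hbh; exact Or.inr (mem_cluster_self _ _ _)
              · exact absurd (hP.closed e a b hends haP (Or.inl hbT) hbh) hbP
            · have hte : e ∉ touches ends P := by
                rintro ⟨x, hx, y, hxy⟩
                rw [hends, Sym2.eq_iff] at hxy
                rcases hxy with ⟨rfl, _⟩ | ⟨_, rfl⟩
                · exact haP hx
                · exact hbP hx
              exact Or.inr (mem_cluster_of_edge haF (by rw [flip_apply_of_notMem hte]; exact he) hends)
      rcases key.2 with h' | h'
      · exact absurd h' hvP
      · exact h'
    · -- blue paths to vertices of `P` stay inside `P ∪ {h}` and are flipped to red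
      have key : v ∈ {x | x ∈ cluster ends (blue ζ) h ∧
          (x ∉ P ∨ x ∈ cluster ends (flip ends P ζ) h)} := by
        refine mem_of_conn_of_closed (ends := ends) (ω := blue ζ) ?_
          ⟨mem_cluster_self _ _ _, Or.inl hhP⟩ hvTp
        intro a ha b hab
        obtain ⟨hne, e, he, hends⟩ := openGraph_adj.1 hab
        have hbTp : b ∈ cluster ends (blue ζ) h := mem_cluster_of_edge ha.1 he hends
        refine ⟨hbTp, ?_⟩
        by_cases hbP : b ∈ P
        · right
          have hte : e ∈ touches ends P := ⟨b, hbP, a, ends_swap hends⟩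
          have hred : flip ends P ζ e = true := by
            rw [flip_apply_of_mem hte]; rw [blue_eq_true_iff] at he; rw [he]; rfl
          rcases ha.2 with haP | haF
          · -- `a ∉ P` on the blue side joined to `b ∈ P`: `a = h`
            by_cases hah : a = h
            · subst hah
              exact mem_cluster_of_edge (mem_cluster_self _ _ _) hred hends
            · exact absurd (hP.closed e b a (ends_swap hends) hbP (Or.inr ha.1) hah) haP
          · exact mem_cluster_of_edge haF hred hends
        · exact Or.inl hbP
      rcases key.2 with h' | h'
      · exact absurd hvP h'
      · exact h'

omit [Fintype E] [DecidableEq E] in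
/-- **The blue cluster after flipping a union of arms.** -/
theorem cluster_blue_flip_of_armClosed (hc : CoreFree ends ζ h) (hP : ArmClosed ends ζ h P) :
    cluster ends (blue (flip ends P ζ)) h =
      (cluster ends (blue ζ) h \ P) ∪ (P ∩ cluster ends ζ h) := by
  rw [blue_flip]
  have := cluster_flip_of_armClosed hc.blue hP.blue
  rw [blue_blue] at this
  exact this

omit [Fintype E] [DecidableEq E] in
/-- The hull is unchanged by an arm flip. -/
theorem hull_flip_of_armClosed (hc : CoreFree ends ζ h) (hP : ArmClosed ends ζ h P) :
    hull ends (flip ends P ζ) h = hull ends ζ h := by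
  unfold hull
  rw [cluster_flip_of_armClosed hc hP, cluster_blue_flip_of_armClosed hc hP]
  ext x
  simp only [Set.mem_union, Set.mem_sdiff, Set.mem_inter_iff]
  constructor
  · rintro ((⟨h1, _⟩ | ⟨_, h2⟩) | (⟨h2, _⟩ | ⟨_, h1⟩))
    · exact Or.inl h1
    · exact Or.inr h2
    · exact Or.inr h2
    · exact Or.inl h1
  · rintro (h1 | h2)
    · by_cases hx : x ∈ P
      · exact Or.inr (Or.inr ⟨hx, h1⟩)
      · exact Or.inl (Or.inl ⟨h1, hx⟩)
    · by_cases hx : x ∈ P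
      · exact Or.inl (Or.inr ⟨hx, h2⟩)
      · exact Or.inr (Or.inl ⟨h2, hx⟩)

omit [Fintype E] [DecidableEq E] in
/-- An arm flip keeps the configuration core-free. -/
theorem coreFree_flip_of_armClosed (hc : CoreFree ends ζ h) (hP : ArmClosed ends ζ h P) :
    CoreFree ends (flip ends P ζ) h := by
  intro x hx hx'
  rw [cluster_flip_of_armClosed hc hP] at hx
  rw [cluster_blue_flip_of_armClosed hc hP] at hx'
  rcases hx with ⟨hT, hP'⟩ | ⟨hP', hTp⟩ <;> rcases hx' with ⟨hTp', hP''⟩ | ⟨hP'', hT'⟩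
  · exact hc x hT hTp'
  · exact absurd hP'' hP'
  · exact absurd hP' hP''
  · exact hc x hT' hTp

/-- An arm flip keeps the outside class. -/
theorem flip_mem_outClass_of_armClosed {U : Set V} {ξ : Config E} (hζ : ζ ∈ outClass ends U h ξ)
    (hc : CoreFree ends ζ h) (hP : ArmClosed ends ζ h P) :
    flip ends P ζ ∈ outClass ends U h ξ := by
  have hpin := (mem_outClass.1 hζ).1
  have hhull := (mem_outClass.1 hζ).2
  rw [mem_outClass]
  refine ⟨fun e he => ?_, ?_⟩
  · have hte : e ∉ touches ends P := by
      rintro ⟨x, hx, y, hxy⟩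
      exact he ⟨x, hhull (hP.subset x hx).1, y, hxy⟩
    rw [flip_apply_of_notMem hte]; exact hpin e he
  · rw [hull_flip_of_armClosed hc hP]; exact hhull

omit [Fintype E] [DecidableEq E] in
/-- The red cluster of `l` grows when red arms are flipped to blue. -/
lemma cluster_l_subset_flip_of_armClosed_red {l : V} (hPT : P ⊆ cluster ends ζ h) (hl : l ∉ P)
    (hhA : h ∉ cluster ends ζ l) :
    cluster ends ζ l ⊆ cluster ends (flip ends P ζ) l := by
  intro v hv
  refine mem_of_conn_of_closed (ends := ends) (ω := ζ)
    (S := {x | x ∈ cluster ends ζ l ∧ x ∉ P ∧ x ∈ cluster ends (flip ends P ζ) l}) ?_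
    ⟨mem_cluster_self _ _ _, hl, mem_cluster_self _ _ _⟩ hv |>.2.2
  intro a ha b hab
  obtain ⟨hne, e, he, hends⟩ := openGraph_adj.1 hab
  have hbA : b ∈ cluster ends ζ l := mem_cluster_of_edge ha.1 he hends
  have hbP : b ∉ P := by
    intro hb
    -- `a` red-joined to `b ∈ P ⊆ C_R(h)`: then `a ∈ C_R(h) ∩ C_R(l)`, so `h ∈ C_R(l)`
    have haT : a ∈ cluster ends ζ h := mem_cluster_of_edge (hPT hb) he (ends_swap hends)
    exact hhA (conn_trans ha.1 (conn_symm haT))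
  have hte : e ∉ touches ends P := by
    rintro ⟨x, hx, y, hxy⟩
    rw [hends, Sym2.eq_iff] at hxy
    rcases hxy with ⟨rfl, _⟩ | ⟨_, rfl⟩
    · exact ha.2.1 hx
    · exact hbP hx
  exact ⟨hbA, hbP, mem_cluster_of_edge ha.2.2 (by rw [flip_apply_of_notMem hte]; exact he) hends⟩

omit [Fintype E] [DecidableEq E] in
/-- The blue cluster of `l` shrinks when red arms are flipped to blue. -/
lemma cluster_blue_flip_subset_of_armClosed_red {l : V} (hc : CoreFree ends ζ h)
    (hP : ArmClosed ends ζ h P) (hPT : P ⊆ cluster ends ζ h) (hl : l ∉ P)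
    (hhB : h ∉ cluster ends (blue ζ) l) :
    cluster ends (blue (flip ends P ζ)) l ⊆ cluster ends (blue ζ) l := by
  intro v hv
  refine mem_of_conn_of_closed (ends := ends) (ω := blue (flip ends P ζ))
    (S := {x | x ∉ P ∧ x ∈ cluster ends (blue ζ) l}) ?_ ⟨hl, mem_cluster_self _ _ _⟩ hv |>.2
  intro a ha b hab
  obtain ⟨hne, e, he, hends⟩ := openGraph_adj.1 hab
  by_cases hte : e ∈ touches ends P
  · -- the edge was red and `b ∈ P ⊆ C_R(h)`; `a ∈ C_B(l) ∩ C_R(h)` outside `P`: impossible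
    exfalso
    have hbP : b ∈ P := by
      rcases hte with ⟨x, hx, y, hxy⟩
      rw [hends, Sym2.eq_iff] at hxy
      rcases hxy with ⟨rfl, _⟩ | ⟨_, rfl⟩
      · exact absurd hx ha.1
      · exact hx
    have hred : ζ e = true := by
      rw [blue_apply, flip_apply_of_mem hte, Bool.not_not] at he; exact he
    have haT : a ∈ cluster ends ζ h := mem_cluster_of_edge (hPT hbP) hred (ends_swap hends)
    have hah : a ≠ h := by rintro rfl; exact hhB ha.2
    exact ha.1 (hP.closed e b a (ends_swap hends) hbP (Or.inl haT) hah)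
  · have hbP : b ∉ P := fun hb => hte ⟨b, hb, a, ends_swap hends⟩
    rw [blue_apply, flip_apply_of_notMem hte] at he
    exact ⟨hbP, mem_cluster_of_edge ha.2 (by rw [blue_apply]; exact he) hends⟩

omit [Fintype E] [DecidableEq E] in
/-- `h` stays red-disconnected from `l` when red arms are flipped to blue. -/
lemma h_notMem_cluster_flip_of_armClosed_red {l : V} (hc : CoreFree ends ζ h)
    (hP : ArmClosed ends ζ h P) (hPT : P ⊆ cluster ends ζ h) (hhA : h ∉ cluster ends ζ l) :
    h ∉ cluster ends (flip ends P ζ) l := by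
  have hhP : h ∉ P := fun hh => (hP.subset h hh).2 rfl
  have hlT : l ∉ cluster ends ζ h := fun h' => hhA (conn_symm h')
  intro hh
  have key : h ∈ {x | x ∉ cluster ends ζ h ∨ x ∈ P} := by
    refine mem_of_conn_of_closed (ends := ends) (ω := flip ends P ζ) ?_ (Or.inl hlT) hh
    intro a ha b hab
    obtain ⟨hne, e, he, hends⟩ := openGraph_adj.1 hab
    by_cases hbP : b ∈ P
    · exact Or.inr hbP
    left
    intro hbT
    by_cases hte : e ∈ touches ends P
    · -- the edge was blue, `a ∈ P` (red arm), `b ∈ C_R(h) ∖ P`: `b = h` contradicts the red star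
      -- edge, `b ≠ h` contradicts arm-closedness
      have haP : a ∈ P := by
        rcases hte with ⟨x, hx, y, hxy⟩
        rw [hends, Sym2.eq_iff] at hxy
        rcases hxy with ⟨rfl, _⟩ | ⟨_, rfl⟩
        · exact hx
        · exact absurd hx hbP
      have hζe : ζ e = false := by
        rw [flip_apply_of_mem hte] at he
        cases hζe : ζ e
        · rfl
        · rw [hζe] at he; exact absurd he (by decide)
      by_cases hbh : b = h
      · subst hbh
        have := red_of_star_red hc (ends_swap hends) (hPT haP) (hP.subset a haP).2
        rw [this] at hζe; exact absurd hζe (by decide)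
      · exact hbP (hP.closed e a b hends haP (Or.inl hbT) hbh)
    · rw [flip_apply_of_notMem hte] at he
      have haP : a ∉ P := fun ha' => hte ⟨a, ha', b, hends⟩
      rcases ha with haT | haP'
      · exact haT (mem_cluster_of_edge hbT he (ends_swap hends))
      · exact haP haP'
  rcases key with h' | h'
  · exact h' (mem_cluster_self _ _ _)
  · exact hhP h'

/-- **Flipping red arms to blue keeps `Q`**: the monotonicity of the conditioning along the arm
cube. -/
theorem flip_mem_tgtU_of_armClosed_red {U : Set V} {l o : V} (hc : CoreFree ends ζ h)
    (hP : ArmClosed ends ζ h P) (hPT : P ⊆ cluster ends ζ h) (hUP : P ⊆ U) (hl : l ∉ U)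
    (hQ : ζ ∈ tgtU ends l h {S : Set V | o ∈ S}) :
    flip ends P ζ ∈ tgtU ends l h {S : Set V | o ∈ S} := by
  have hlP : l ∉ P := fun h' => hl (hUP h')
  simp only [tgtU, Finset.mem_filter, Finset.mem_univ, true_and, Set.mem_setOf_eq, hull,
    Set.mem_union, not_or] at hQ ⊢
  obtain ⟨⟨hhA, hhB⟩, hoA, hoB⟩ := hQ
  refine ⟨⟨h_notMem_cluster_flip_of_armClosed_red hc hP hPT hhA, ?_⟩, ?_, ?_⟩
  · exact fun h' => hhB (cluster_blue_flip_subset_of_armClosed_red hc hP hPT hlP hhB h')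
  · exact cluster_l_subset_flip_of_armClosed_red hPT hlP hhA hoA
  · exact fun h' => hoB (cluster_blue_flip_subset_of_armClosed_red hc hP hPT hlP hhB h')

end ArmFlip

end LocRows

end Summit.Ventures.PercRepro2
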